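import Summits.QuantumFields.GaugeBoot.BootstrapCertificatesSuN
import Summits.QuantumFields.GaugeBoot.StrongCouplingOrderPlaquette
import HarnessLib

/-!
# The plaquette: every strict bound on `⟨u_P⟩_β` and on the mean plaquette has an SOS ⊕ loop-equation certificate (gauge-boot, L1/L4 supplement)

HONEST FRAMING (cell `pub-gaugeboot`, page 1 of every file): the venture produces certified bounds
on lattice expectations at stated coupling, gauge group, dimension and torus size; NOT a mass gap,
NOT a continuum limit, NOT a string tension; NOT Yang–Mills-summit-bearing (barriers
`FixedCouplingUltralocality`, `PerturbativeInvisibility`). Structural; it certifies no number: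
it says that certificates of the kind the cell produces EXIST for every true strict bound, not
at which level, and exhibits none.

## Content (`SU(N)` fundamental on the torus `(ℤ/L)^d`, every `d`, `L ≥ 1`, `N`, every real `β`)

The cell's certified objects, the plaquette `u_P = (1/N) Re tr U_P` (`plaquetteTraceCM`) and its
torus average (`meanPlaquetteCM`), are test functions of word length `4`
(`StrongCouplingOrderPlaquette.lean`), hence objectives of every level `n ≥ 2`
(`plaquetteTraceCM_mem_certDomainSuN`). By `BootstrapCertificatesSuN.lean`:

* ★★★ `exists_plaquette_certificate_suN` — at every level `n ≥ 2`, every constant strictly above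
  the level-`n` SDP upper bound of `u_P` has a level-`n` certificate
  `c • 1 - u_P = Σ_j v_j² + Σ_l λ_l (f_l' - β f_l S_l')` (no duality gap for the plaquette SDP);
  `exists_meanPlaquette_certificate_suN` likewise;
* ★★★ `exists_certificate_of_plaquette_lt_suN`, `exists_certificate_of_lt_plaquette_suN`,
  `exists_plaquette_window_certificates_suN` (+ mean plaquette) — every `c > ⟨u_P⟩_β`, every
  `c < ⟨u_P⟩_β`, every open window around `⟨ū_P⟩_β` is certified at some level.

References: Anderson–Kruczenski (2017) §3; Kazakov–Zheng, arXiv:2203.11360 §4 (plaquette bounds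
from the primal/dual SDP); Josz–Henrion, Optim. Lett. 10 (2016) 3. Folklore.
-/

noncomputable section

open MeasureTheory Filter Topology NormedSpace
open Literature.MathematicalPhysics.QuantumFieldTheory (LatticeRep Edge Site GaugeConfig wilsonAction
  wilsonMeasure)
open Literature.MathematicalPhysics.QuantumLattice

namespace Summit.QuantumFields.GaugeBoot

section SuN

variable {d L : ℕ} [NeZero L] (N : ℕ) (β : ℝ)

/-- **The plaquette is an objective of every level `n ≥ 2`.** -/
theorem plaquetteTraceCM_mem_certDomainSuN (x : Site d L) (i j : Fin d) {n : ℕ} (hn : 2 ≤ n) :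
    plaquetteTraceCM (fundamentalLatticeRep N) x i j ∈ certDomainSuN (d := d) (L := L) N β n :=
  mem_certDomainSuN_of_mem_wordTruncation N β (by omega)
    (plaquetteTraceCM_mem_wordTruncation (fundamentalLatticeRep N) x i j)

/-- **The mean plaquette is an objective of every level `n ≥ 2`.** -/
theorem meanPlaquetteCM_mem_certDomainSuN {n : ℕ} (hn : 2 ≤ n) :
    meanPlaquetteCM (d := d) (L := L) (fundamentalLatticeRep N) ∈
      certDomainSuN (d := d) (L := L) N β n :=
  mem_certDomainSuN_of_mem_wordTruncation N β (by omega)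
    (meanPlaquetteCM_mem_wordTruncation (fundamentalLatticeRep N))

/-- ★★★ **No duality gap for the plaquette SDP**: at every level `n ≥ 2`, every constant strictly
above the level-`n` upper bound of `u_P` has a level-`n` SOS ⊕ loop-equation certificate.
[folklore] -/
theorem exists_plaquette_certificate_suN (x : Site d L) (i j : Fin d) {n : ℕ} (hn : 2 ≤ n)
    {c c' : ℝ}
    (h : ∀ t ∈ levelValuesSuN (d := d) (L := L) N β n (plaquetteTraceCM (fundamentalLatticeRep N) x i j),
      t ≤ c) (hc : c < c') :
    ∃ σ ∈ sosCone (wordTruncation (ι := Edge d L) (fundamentalLatticeRep N) n),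
      ∃ ρ ∈ rowSpace (fundamentalLatticeRep N) (suExp N) (fun _ => wilsonAction (fundamentalRep (Fin N)))
        β (wordTruncation (ι := Edge d L) (fundamentalLatticeRep N) n),
        σ + ρ = c' • (1 : C(GaugeConfig d L (Matrix.specialUnitaryGroup (Fin N) ℂ), ℝ)) -
          plaquetteTraceCM (fundamentalLatticeRep N) x i j :=
  exists_certificate_suN N β (plaquetteTraceCM_mem_certDomainSuN N β x i j hn) h hc

/-- ★★★ **No duality gap for the mean-plaquette SDP** (level `n ≥ 2`). [folklore] -/
theorem exists_meanPlaquette_certificate_suN {n : ℕ} (hn : 2 ≤ n) {c c' : ℝ}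
    (h : ∀ t ∈ levelValuesSuN (d := d) (L := L) N β n (meanPlaquetteCM (fundamentalLatticeRep N)),
      t ≤ c) (hc : c < c') :
    ∃ σ ∈ sosCone (wordTruncation (ι := Edge d L) (fundamentalLatticeRep N) n),
      ∃ ρ ∈ rowSpace (fundamentalLatticeRep N) (suExp N) (fun _ => wilsonAction (fundamentalRep (Fin N)))
        β (wordTruncation (ι := Edge d L) (fundamentalLatticeRep N) n),
        σ + ρ = c' • (1 : C(GaugeConfig d L (Matrix.specialUnitaryGroup (Fin N) ℂ), ℝ)) -
          meanPlaquetteCM (fundamentalLatticeRep N) :=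
  exists_certificate_suN N β (meanPlaquetteCM_mem_certDomainSuN N β hn) h hc

/-- ★★ **The level-`n` plaquette bounds form a compact interval around `⟨u_P⟩_β`** whose upper
end is the infimum of the level-`n` certified bounds. [folklore] -/
theorem plaquette_levelValues_eq_Icc_suN (x : Site d L) (i j : Fin d) {n : ℕ} (hn : 2 ≤ n) :
    ∃ lo hi : ℝ,
      levelValuesSuN (d := d) (L := L) N β n (plaquetteTraceCM (fundamentalLatticeRep N) x i j) =
          Set.Icc lo hi ∧
        ∫ U, plaquetteTrace (fundamentalRep (Fin N)) x i j U ∂(wilsonMeasure (fundamentalRep (Fin N)) β)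
          ∈ Set.Icc lo hi ∧
        hi = sInf {c : ℝ | c • (1 : C(GaugeConfig d L (Matrix.specialUnitaryGroup (Fin N) ℂ), ℝ)) -
          plaquetteTraceCM (fundamentalLatticeRep N) x i j ∈ certConeSuN (d := d) (L := L) N β n} := by
  have hP := plaquetteTraceCM_mem_certDomainSuN N β x i j hn
  obtain ⟨lo, hi, h, hW⟩ := levelValues_eq_Icc_suN N β hP
  rw [coe_plaquetteTraceCM] at hW
  refine ⟨lo, hi, h, hW, ?_⟩
  rw [← sSup_levelValues_eq_sInf_suN N β hP, h]
  exact (csSup_Icc (hW.1.trans hW.2)).symm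

/-- ★★★ **Every strict upper bound on the plaquette expectation is certified**: for every
`c > ⟨u_P⟩_β` there are a level `n` and a certificate `c • 1 - u_P = σ + ρ`. [folklore] -/
theorem exists_certificate_of_plaquette_lt_suN (x : Site d L) (i j : Fin d) {c : ℝ}
    (hc : ∫ U, plaquetteTrace (fundamentalRep (Fin N)) x i j U ∂(wilsonMeasure (fundamentalRep (Fin N)) β)
      < c) :
    ∃ n : ℕ, ∃ σ ∈ sosCone (wordTruncation (ι := Edge d L) (fundamentalLatticeRep N) n),
      ∃ ρ ∈ rowSpace (fundamentalLatticeRep N) (suExp N) (fun _ => wilsonAction (fundamentalRep (Fin N)))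
        β (wordTruncation (ι := Edge d L) (fundamentalLatticeRep N) n),
        σ + ρ = c • (1 : C(GaugeConfig d L (Matrix.specialUnitaryGroup (Fin N) ℂ), ℝ)) -
          plaquetteTraceCM (fundamentalLatticeRep N) x i j :=
  exists_certificate_of_wilson_lt_suN N β (wordTruncation_subset_polyAlgebra _ 4
    (plaquetteTraceCM_mem_wordTruncation (fundamentalLatticeRep N) x i j))
    (by rwa [coe_plaquetteTraceCM])

/-- ★★★ **Every strict lower bound on the plaquette expectation is certified.** [folklore] -/
theorem exists_certificate_of_lt_plaquette_suN (x : Site d L) (i j : Fin d) {c : ℝ}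
    (hc : c < ∫ U, plaquetteTrace (fundamentalRep (Fin N)) x i j U
      ∂(wilsonMeasure (fundamentalRep (Fin N)) β)) :
    ∃ n : ℕ, ∃ σ ∈ sosCone (wordTruncation (ι := Edge d L) (fundamentalLatticeRep N) n),
      ∃ ρ ∈ rowSpace (fundamentalLatticeRep N) (suExp N) (fun _ => wilsonAction (fundamentalRep (Fin N)))
        β (wordTruncation (ι := Edge d L) (fundamentalLatticeRep N) n),
        σ + ρ = plaquetteTraceCM (fundamentalLatticeRep N) x i j -
          c • (1 : C(GaugeConfig d L (Matrix.specialUnitaryGroup (Fin N) ℂ), ℝ)) :=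
  exists_certificate_of_lt_wilson_suN N β (wordTruncation_subset_polyAlgebra _ 4
    (plaquetteTraceCM_mem_wordTruncation (fundamentalLatticeRep N) x i j))
    (by rwa [coe_plaquetteTraceCM])

/-- ★★★ **Every open window around the mean-plaquette expectation is certified from both sides
at one level** — the shape of the cell's two-sided plaquette certificates. [folklore] -/
theorem exists_meanPlaquette_window_certificates_suN {a b : ℝ}
    (ha : a < ∫ U, meanPlaquette (d := d) (L := L) (fundamentalRep (Fin N)) U
      ∂(wilsonMeasure (fundamentalRep (Fin N)) β))
    (hb : ∫ U, meanPlaquette (d := d) (L := L) (fundamentalRep (Fin N)) U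
      ∂(wilsonMeasure (fundamentalRep (Fin N)) β) < b) :
    ∃ n : ℕ,
      meanPlaquetteCM (fundamentalLatticeRep N) -
          a • (1 : C(GaugeConfig d L (Matrix.specialUnitaryGroup (Fin N) ℂ), ℝ)) ∈
        certConeSuN (d := d) (L := L) N β n ∧
      b • (1 : C(GaugeConfig d L (Matrix.specialUnitaryGroup (Fin N) ℂ), ℝ)) -
          meanPlaquetteCM (fundamentalLatticeRep N) ∈
        certConeSuN (d := d) (L := L) N β n :=
  exists_certificates_of_wilson_mem_Ioo_suN N β (wordTruncation_subset_polyAlgebra _ 4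
    (meanPlaquetteCM_mem_wordTruncation (fundamentalLatticeRep N)))
    (by rwa [coe_meanPlaquetteCM]) (by rwa [coe_meanPlaquetteCM])

/-- ★★★ **Every open window around a single plaquette expectation is certified at one level.**
[folklore] -/
theorem exists_plaquette_window_certificates_suN (x : Site d L) (i j : Fin d) {a b : ℝ}
    (ha : a < ∫ U, plaquetteTrace (fundamentalRep (Fin N)) x i j U
      ∂(wilsonMeasure (fundamentalRep (Fin N)) β))
    (hb : ∫ U, plaquetteTrace (fundamentalRep (Fin N)) x i j U
      ∂(wilsonMeasure (fundamentalRep (Fin N)) β) < b) :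
    ∃ n : ℕ,
      plaquetteTraceCM (fundamentalLatticeRep N) x i j -
          a • (1 : C(GaugeConfig d L (Matrix.specialUnitaryGroup (Fin N) ℂ), ℝ)) ∈
        certConeSuN (d := d) (L := L) N β n ∧
      b • (1 : C(GaugeConfig d L (Matrix.specialUnitaryGroup (Fin N) ℂ), ℝ)) -
          plaquetteTraceCM (fundamentalLatticeRep N) x i j ∈
        certConeSuN (d := d) (L := L) N β n :=
  exists_certificates_of_wilson_mem_Ioo_suN N β (wordTruncation_subset_polyAlgebra _ 4
    (plaquetteTraceCM_mem_wordTruncation (fundamentalLatticeRep N) x i j))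
    (by rwa [coe_plaquetteTraceCM]) (by rwa [coe_plaquetteTraceCM])

end SuN

end Summit.QuantumFields.GaugeBoot

end
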